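import Summits.FinalStateConjecture.FinalStateConjecture.Theorems.EIHFluxBalanceInertialRecessionStubMomRowLinearRow
import Summits.FinalStateConjecture.FinalStateConjecture.Theorems.EIHFluxBalanceInertialRecessionStubCoerMomQuantJets
import Literature.Geometry.Lorentzian.FlatChartComputations

/-!
# Route EIHFluxBalance — `InertialRecession` (E′), line `SketchCleanExcision`, skeleton r13,
# stub `stub_coerMomKernel` (Bk), analytic half, part 1: the momentum rows over the FLAT base

Helper file for the crux `stmt-FinalStateConjecture-17403`
(`Summit.FinalStateConjecture.FinalStateConjecture.Theses.EIHFluxBalance.InertialRecession`, E′),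
registered stub `stub_coerMomKernel` (Bk) of skeleton r13 (seat 1, analytic half of Bk).

The far-field (graded) limit of Bk's hypothesis lands on the momentum rows of a first-order
modulated model over the CONSTANT Minkowski base, `G' z = η + z⁰ V z`.  The momentum-row formula
`momRow_ricAt_sub_eq_sum` (stub ML, …StubMomRowLinearRow) collapses there — `♯_η` is constant,
the Koszul form and the Christoffel map of `η` vanish — to the flat momentum operator:

* `bk_sharpAt_minkowski` — `♯_η α = (−α(e₀), α(e₁), α(e₂), α(e₃))` (the constant components
  `η` are metric components on `E4`, cf. `KerrWindow.isMetricOn_minkowski_const`);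
* `bk_flatRow` — **`Ric(η + x⁰V)(x)(♯_η dx⁰, e) = ½ Σᵢ (∂_e V(eᵢ,eᵢ) − ∂_{eᵢ} V(eᵢ,e))(x)`** at a
  slice point `x⁰ = 0`, for `e` spatial (`i` over the spatial coordinate vectors): the
  linearised momentum constraint `δ(∂ᵢKᵢⱼ − ∂ⱼ tr K)` of the flat slice, `K = −½V|_{slice}`.

Pure coordinate tensor algebra; no definitions, no named facts, no `sorry`.
-/

set_option linter.dupNamespace false
set_option maxSynthPendingDepth 3

noncomputable section

open Set Function Filter ContinuousLinearMap Literature.Geometry.Lorentzian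
  Literature.Geometry.Lorentzian.MetricCoord
open scoped Topology ContDiff

namespace Summit.FinalStateConjecture.FinalStateConjecture.Theorems.SublinearIsFree.Slaving

/-- **Index raising with the constant Minkowski components**:
`♯_η α = (−α(e₀), α(e₁), α(e₂), α(e₃))`. [cite: ONeill1983, Ch. 3, p. 60] -/
theorem bk_sharpAt_minkowski (x : E4) (α : E4 →L[ℝ] ℝ) :
    sharpAt (fun _ : E4 ↦ Minkowski.bilin) x α =
      WithLp.toLp 2 ![-(α (E4.basisVector 0)), α (E4.basisVector 1), α (E4.basisVector 2),
        α (E4.basisVector 3)] := by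
  have hinv : (Minkowski.bilin).IsInvertible :=
    isInvertible_of_nondegenerate Minkowski.bilin_nondegenerate
  refine sharpAt_eq_of_forall (G := fun _ : E4 ↦ Minkowski.bilin) hinv fun w ↦ ?_
  have hw : w = w 0 • E4.basisVector 0 + w 1 • E4.basisVector 1 + w 2 • E4.basisVector 2
      + w 3 • E4.basisVector 3 := by
    ext i; fin_cases i <;> simp
  conv_rhs => rw [hw]
  simp only [map_add, map_smul, smul_eq_mul, Minkowski.bilin_apply, Fin.sum_univ_three]
  simp
  ring

set_option maxHeartbeats 1600000 in
/-- **The momentum rows over the flat base.** For `V` smooth with symmetric values on an open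
`U ∋ x`, `x⁰ = 0`, and `e` spatial (`e⁰ = 0`):
`Ric(η + x⁰V)(x)(♯_η dx⁰, e) = ½ Σᵢ (D V(x)(e)(eᵢ,eᵢ) − D V(x)(eᵢ)(eᵢ,e))`, `i` over the three
spatial coordinate vectors — the momentum-row formula `momRow_ricAt_sub_eq_sum` with all
`D♯`, Koszul and Christoffel terms of the constant base vanishing (the linearised momentum
constraint of the slice `{x⁰ = 0}` of Minkowski space). [cite: ONeill1983, Ch. 3, Lemma 3.52] -/
theorem bk_flatRow {V : E4 → E4 →L[ℝ] E4 →L[ℝ] ℝ} {U : Set E4} {x : E4}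
    (hU : IsOpen U) (hxU : x ∈ U) (hx0 : x 0 = 0) (hV : ContDiffOn ℝ ∞ V U)
    (hVs : ∀ z ∈ U, ∀ v w : E4, V z v w = V z w v) {e : E4} (he : e 0 = 0) :
    ricAt (fun z : E4 ↦ Minkowski.bilin + (z 0) • V z) x
        (sharpAt (fun _ : E4 ↦ Minkowski.bilin) x (E4.dx 0)) e
      = 2⁻¹ * ∑ i : Fin 3, (fderiv ℝ V x e (E4.basisVector i.succ) (E4.basisVector i.succ)
          - fderiv ℝ V x (E4.basisVector i.succ) (E4.basisVector i.succ) e) := by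
  set G : E4 → E4 →L[ℝ] E4 →L[ℝ] ℝ := fun _ ↦ Minkowski.bilin with hG
  have hGm : IsMetricOn G (univ : Set E4) :=
    { isOpen := isOpen_univ
      contDiffOn := contDiffOn_const
      symm := fun _ _ v w ↦ Minkowski.bilin_symm v w
      isInvertible := fun _ _ ↦ isInvertible_of_nondegenerate Minkowski.bilin_nondegenerate }
  -- a common domain on which both fields are metric components
  obtain ⟨V', hV'o, hxV', -, hV'U, hGV', hG'V'⟩ :=
    coerMomQ_isMetricOn_add_slice_smul hGm (mem_univ x) hx0 hV hU hxU hVs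
  -- the jets at `x`
  obtain ⟨h0, h1, h2⟩ :=
    coerMomQ_jets_add_slice_smul hGV'.contDiffOn (hV.mono hV'U) hV'o hxV' hx0
  set n : E4 →L[ℝ] ℝ := E4.dx 0 with hn
  set A₁ : E4 →L[ℝ] E4 →L[ℝ] ℝ := V x with hA₁
  set P : E4 →L[ℝ] E4 →L[ℝ] E4 →L[ℝ] ℝ := fderiv ℝ V x with hP
  have hAs : ∀ v w : E4, A₁ v w = A₁ w v := fun v w ↦ hVs x hxU v w
  have hne : n e = 0 := by simp [hn, he]
  -- symmetry of `P v` (derivative of a field with symmetric values)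
  have hPs : ∀ v Y Z : E4, P v Y Z = P v Z Y := by
    intro v Y Z
    have hd : DifferentiableAt ℝ V x :=
      ((hV.contDiffAt (hU.mem_nhds hxU)).differentiableAt (by simp))
    have hev : (fun z ↦ V z Y Z) =ᶠ[𝓝 x] fun z ↦ V z Z Y := by
      filter_upwards [hU.mem_nhds hxU] with z hz
      exact hVs z hz Y Z
    have happ : ∀ Y' Z' : E4, fderiv ℝ (fun z ↦ V z Y' Z') x v = P v Y' Z' := by
      intro Y' Z'
      have h1 : DifferentiableAt ℝ (fun z ↦ V z Y') x := differentiableAt_clm_apply_const hd Y'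
      rw [fderiv_clm_apply_const h1 Z' v, fderiv_clm_apply_const hd Y' v]
    rw [← happ Y Z, ← happ Z Y, hev.fderiv_eq]
  -- the momentum-row formula, basis = coordinate basis
  set b : Module.Basis (Fin 4) ℝ E4 := (EuclideanSpace.basisFun (Fin 4) ℝ).toBasis with hb
  have hbi : ∀ i, b i = E4.basisVector i := fun i ↦ by
    simp [hb, EuclideanSpace.basisFun_apply]
  have hbc : ∀ i (v : E4), b.coord i v = v i := fun i v ↦ by
    simp [hb, Module.Basis.coord_apply]
  have key := momRow_ricAt_sub_eq_sum_s0 hGV' hG'V' hxV' h0 h1 h2 hAs hne b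
  -- the flat base: `Ric η = 0`, `D♯ = 0`, Koszul form and Christoffel map vanish
  have hric0 : ricAt G x = 0 := ricAt_constMetric Minkowski.bilin x
  have hDsharp : fderiv ℝ (sharpAt G) x = 0 := by
    have : sharpAt G = fun _ : E4 ↦ (Minkowski.bilin).inverse := rfl
    rw [this]
    simp
  have hkos : koszulCLM G x = 0 := koszulCLM_constMetric Minkowski.bilin x
  have hchr : chrAt G x = 0 := chrAt_constMetric Minkowski.bilin x
  have hsharp : ∀ α : E4 →L[ℝ] ℝ, sharpAt G x α =
      WithLp.toLp 2 ![-(α (E4.basisVector 0)), α (E4.basisVector 1), α (E4.basisVector 2),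
        α (E4.basisVector 3)] := bk_sharpAt_minkowski x
  have hsn : sharpAt G x n = -E4.basisVector 0 := by
    rw [hsharp]
    ext i; fin_cases i <;> simp [hn]
  rw [hric0] at key
  simp only [_root_.zero_apply, sub_zero] at key
  rw [key]
  simp only [hDsharp, hkos, hchr, _root_.zero_apply, map_zero, smul_zero, sub_zero, zero_add,
    hsn, map_neg, neg_apply]
  simp only [hbc, hbi, Fin.sum_univ_four, Fin.sum_univ_three, hsharp, koszulOp_apply,
    _root_.add_apply, _root_.smul_apply, ContinuousLinearMap.smulRight_apply, smul_eq_mul,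
    neg_apply, map_add, map_smul, hn]
  simp [he]
  rw [hPs (E4.basisVector 0) e (E4.basisVector 0), hPs (E4.basisVector 1) e (E4.basisVector 1),
    hPs (E4.basisVector 2) e (E4.basisVector 2), hPs (E4.basisVector 3) e (E4.basisVector 3)]
  ring

/-- **Registered carrier** `bk_flatRow_carrier` of the crux item (one-line form of a lemma of this file,
for the `--supports` protocol). [folklore] -/
theorem bk_flatRow_carrier : open Literature.Geometry.Lorentzian in ∀ (x : E4) (α : E4 →L[ℝ] ℝ), MetricCoord.sharpAt (fun _ : E4 ↦ Minkowski.bilin) x α = WithLp.toLp 2 ![-(α (E4.basisVector 0)), α (E4.basisVector 1), α (E4.basisVector 2), α (E4.basisVector 3)] :=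
  bk_sharpAt_minkowski

end Summit.FinalStateConjecture.FinalStateConjecture.Theorems.SublinearIsFree.Slaving

end
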